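import Summits.NavierStokesRegularity.NavierStokesRegularity.Theorems.EpisodeBaseT.Negative.RingFamilyThinAnchorIff
import HarnessLib

/-!
# Tightness of the two-sided exclusions: for small amplitudes, «blob + μ₁ ring above + μ₂ mirror ring below» at the
# thinness of record IS level-0 data iff `|μ₂| < |μ₁|` (Negative lane, `EpisodeBaseT`, line «doormirror», stub D2a)

Cell `ns-blowup`, seat `ns-blowup-refuter4` (g12; D-0074 GROUP C «BRIDGE SUPPORT», Negative lane (α)). Eighth file of the
mirror series (p567521, p569185, p572223, p572865, p578128, p579200, p579821).

p579821 showed: every level-0 member of the family `U = tinyProfileAt R a + (μ₁ • ringPusher ringThin + μ₂ • mirrorRingPusher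
ringThin)` has `|μ₂| < |μ₁|`, and at the ceiling point the strict anchor holds iff `|μ₂| < |μ₁|`. This file proves the
exclusions are TIGHT: in fc-prover-2's small-amplitude regime (`0 < a ≤ 5/256`, `a ≤ 5/N₀`, `a ≤ strainConst/N₀`,
`|μ₁| (M + 1) ≤ Y₀/2`, `M = ringSpeed`) the member IS level-0 data in `B̄(0, 7)` as soon as `|μ₂| < |μ₁|`
(`levelZeroDataAt_ringFamilyThin`, the two-sided version of fc-prover-2's `levelZeroDataAt_sterileCarrierAt`, p565496:
ceiling and unique argmax from the disjoint far supports, floor / strain / core from the blob, anchor from p579821), hence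

* `levelZeroDataAt_ringFamilyThin_iff` — in that regime, `LevelZeroDataAt R U 7 ↔ |μ₂| < |μ₁|`.

So in this design class level 0 is EXACTLY one strict inequality between the two ring amplitudes; the signs of `μ₁`, `μ₂`
are free (p578128) and `μ₁ = 0`, `|μ₁| = |μ₂|` are the sterile boundary (p569185, p572223, p578128).

LABEL: kernel analysis (theorems only; no `def`). WHAT THIS IS NOT: not Navier–Stokes evidence; not a refutation of D2a or
of any route item; a static statement about explicit compactly supported profiles and the level-0 predicate — no flow,
stage, schedule or certificate; sorry-free, std axioms.
bears_on: LADDER-NS N1 (route-NavierStokesRegularity-PalasekTowerBreakdown), item 20303, stub D2a.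

References: S. Palasek, arXiv:2605.13827 §3.3 [cite: Palasek2026ElementaryModel, §3.3]; A. J. Majda, A. L. Bertozzi
(CUP 2002) §1.8 Prop. 1.16 [cite: MajdaBertozziCUP2002, §1.8 Prop. 1.16].
-/

noncomputable section

open Literature.Analysis.FluidPDE
open Summit.NavierStokesRegularity.FluidComputer.PalasekTowerClayBridge
open Summit.NavierStokesRegularity.FluidComputer.PalasekTowerClayBridge.TinyBlob
open Summit.NavierStokesRegularity.FluidComputer.PalasekTowerClayBridge.Germ
open Summit.NavierStokesRegularity.EpisodeBaseTRingPusherMirrorAnchorSign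
open Summit.NavierStokesRegularity.EpisodeBaseTTwoSidedRingFamilyAnchorLaw
open Summit.NavierStokesRegularity.EpisodeBaseTRingFamilyThinAnchorIff
open MeasureTheory InnerProductSpace Metric Set Filter
open scoped RealInnerProductSpace ContDiff Topology

namespace Summit.NavierStokesRegularity.EpisodeBaseTRingFamilyThinLevelZeroIff

variable {R : TowerRates} {a μ₁ μ₂ : ℝ}

/-! ## §1 Near / far, the speed bound of the two rings, ceiling and unique argmax -/

/-- Near the origin (`‖x‖ < 9/2`) the member is the blob. [folklore] -/
theorem ringFamilyThin_near (R : TowerRates) (a μ₁ μ₂ : ℝ) {x : EuclideanSpace ℝ (Fin 3)} (hx : ‖x‖ < 9 / 2) :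
    (tinyProfileAt R a + (μ₁ • ringPusher ringThin + μ₂ • mirrorRingPusher ringThin)) x = tinyProfileAt R a x := by
  rw [Pi.add_apply, ringFamily_eq_zero_of_norm_lt ringThin_spec.1 ringThin_spec.2.1 μ₁ μ₂ hx, add_zero]

/-- Away from the blob (`2a < ‖x‖`, `0 < a`) the member is the two rings. [folklore] -/
theorem ringFamilyThin_far (ha : 0 < a) (μ₁ μ₂ : ℝ) {x : EuclideanSpace ℝ (Fin 3)} (hx : 2 * a < ‖x‖) :
    (tinyProfileAt R a + (μ₁ • ringPusher ringThin + μ₂ • mirrorRingPusher ringThin)) x =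
      (μ₁ • ringPusher ringThin + μ₂ • mirrorRingPusher ringThin) x := by
  have h0 : tinyProfileAt R a x = 0 := image_eq_zero_of_notMem_tsupport fun hm => by
    have h := tsupport_tinyProfileAt_subset (R := R) ha hm
    rw [mem_closedBall, dist_zero_right] at h
    linarith
  rw [Pi.add_apply, h0, zero_add]

/-- **Speed of the two rings**: `‖(μ₁ • P + μ₂ • P♭) x‖ ≤ max |μ₁| |μ₂| · M` (disjoint supports; `M = ringSpeed`). [folklore] -/
theorem norm_ringFamilyThin_le (μ₁ μ₂ : ℝ) (x : EuclideanSpace ℝ (Fin 3)) :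
    ‖(μ₁ • ringPusher ringThin + μ₂ • mirrorRingPusher ringThin) x‖ ≤ max |μ₁| |μ₂| * ringSpeed := by
  obtain ⟨hM0, hM⟩ := ringSpeed_spec
  rcases ringPusher_or_mirrorRingPusher_eq_zero ringThin_spec.1 ringThin_spec.2.1 x with h | h
  · rw [Pi.add_apply, Pi.smul_apply, Pi.smul_apply, h, smul_zero, zero_add, norm_smul, Real.norm_eq_abs]
    have h1 : ‖mirrorRingPusher ringThin x‖ ≤ ringSpeed := by
      rw [mirrorRingPusher, mirrorZ.norm_map]
      exact hM _
    calc |μ₂| * ‖mirrorRingPusher ringThin x‖ ≤ |μ₂| * ringSpeed := mul_le_mul_of_nonneg_left h1 (abs_nonneg _)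
      _ ≤ max |μ₁| |μ₂| * ringSpeed := mul_le_mul_of_nonneg_right (le_max_right _ _) hM0
  · rw [Pi.add_apply, Pi.smul_apply, Pi.smul_apply, h, smul_zero, add_zero, norm_smul, Real.norm_eq_abs]
    calc |μ₁| * ‖ringPusher ringThin x‖ ≤ |μ₁| * ringSpeed := mul_le_mul_of_nonneg_left (hM x) (abs_nonneg _)
      _ ≤ max |μ₁| |μ₂| * ringSpeed := mul_le_mul_of_nonneg_right (le_max_left _ _) hM0

/-- **Ceiling and unique argmax** (`0 < a ≤ 1/2`, `|μ₂| ≤ |μ₁|`, `|μ₁| (M + 1) ≤ Y₀/2`): `‖U x‖ ≤ Y₀` everywhere, with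
equality only at `x = 0`. [folklore] -/
theorem norm_ringFamilyThin_le_Y (ha : 0 < a) (ha2 : a ≤ 1 / 2) (hle : |μ₂| ≤ |μ₁|)
    (hmuY : |μ₁| * (ringSpeed + 1) ≤ R.Y 0 / 2) :
    (∀ x, ‖(tinyProfileAt R a + (μ₁ • ringPusher ringThin + μ₂ • mirrorRingPusher ringThin)) x‖ ≤ R.Y 0) ∧
      ∀ x, ‖(tinyProfileAt R a + (μ₁ • ringPusher ringThin + μ₂ • mirrorRingPusher ringThin)) x‖ = R.Y 0 → x = 0 := by
  obtain ⟨hM0, -⟩ := ringSpeed_spec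
  have hY := R.Y_pos 0
  have hmax : max |μ₁| |μ₂| = |μ₁| := max_eq_left hle
  have hpush : ∀ x, ‖(μ₁ • ringPusher ringThin + μ₂ • mirrorRingPusher ringThin) x‖ < R.Y 0 := fun x => by
    have h1 := norm_ringFamilyThin_le μ₁ μ₂ x
    rw [hmax] at h1
    nlinarith [abs_nonneg μ₁]
  refine ⟨fun x => ?_, fun x hx => ?_⟩
  · by_cases h : ‖x‖ < 9 / 2
    · rw [ringFamilyThin_near R a μ₁ μ₂ h]
      exact norm_tinyProfileAt_le ha.ne' x
    · rw [ringFamilyThin_far ha μ₁ μ₂ (by push Not at h; linarith)]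
      exact (hpush x).le
  · by_cases h : ‖x‖ < 9 / 2
    · rw [ringFamilyThin_near R a μ₁ μ₂ h] at hx
      exact eq_zero_of_norm_tinyProfileAt_eq ha.ne' hx
    · rw [ringFamilyThin_far ha μ₁ μ₂ (by push Not at h; linarith)] at hx
      exact absurd hx (hpush x).ne

/-! ## §2 Static data and the strict slot -/

/-- The member is smooth, divergence free, supported in `B̄(0, 7)` (`0 < a ≤ 1/2`). [folklore] -/
theorem ringFamilyThin_static (ha : 0 < a) (ha2 : a ≤ 1 / 2) (μ₁ μ₂ : ℝ) :
    ContDiff ℝ ∞ (tinyProfileAt R a + (μ₁ • ringPusher ringThin + μ₂ • mirrorRingPusher ringThin)) ∧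
      VectorCalculus.IsDivFree (tinyProfileAt R a + (μ₁ • ringPusher ringThin + μ₂ • mirrorRingPusher ringThin)) ∧
      tsupport (tinyProfileAt R a + (μ₁ • ringPusher ringThin + μ₂ • mirrorRingPusher ringThin)) ⊆
        closedBall (0 : EuclideanSpace ℝ (Fin 3)) 7 := by
  have h₂ := contDiff_ringFamily ringThin μ₁ μ₂
  have hdiv₂ := isDivFree_ringFamily ringThin μ₁ μ₂
  refine ⟨(contDiff_tinyProfileAt R a).add h₂, fun x => ?_, ?_⟩
  · have h1 := isDivFree_tinyProfileAt (R := R) ha.ne' x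
    have h2 := hdiv₂ x
    show VectorCalculus.divergence
      (fun y => tinyProfileAt R a y + (μ₁ • ringPusher ringThin + μ₂ • mirrorRingPusher ringThin) y) x = 0
    rw [divergence_add_apply ((contDiff_tinyProfileAt R a).differentiable (by simp) x) (h₂.differentiable (by simp) x),
      h1, h2, add_zero]
  · refine (tsupport_add _ _).trans (union_subset ((tsupport_tinyProfileAt_subset ha).trans
      (closedBall_subset_closedBall (by linarith))) ((tsupport_add _ _).trans (union_subset ?_ ?_)))
    · have h := tsupport_smul_subset_right (fun _ : EuclideanSpace ℝ (Fin 3) => μ₁) (ringPusher ringThin)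
      exact h.trans (tsupport_ringPusher_subset_closedBall ringThin_spec.1 ringThin_spec.2.1)
    · have h := tsupport_smul_subset_right (fun _ : EuclideanSpace ℝ (Fin 3) => μ₂) (mirrorRingPusher ringThin)
      exact h.trans (tsupport_mirrorRingPusher_subset_closedBall ringThin_spec.1 ringThin_spec.2.1)

/-- **THE TWO-SIDED MEMBER FILLS THE STRICT SLOT WHEN THE RING ABOVE OUT-WEIGHS THE RING BELOW**:
`LevelZeroDataAt R (tinyProfileAt R a + (μ₁ • ringPusher ringThin + μ₂ • mirrorRingPusher ringThin)) 7` for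
`0 < a ≤ 5/256`, `a ≤ 5/N₀(R)`, `a ≤ strainConst/N₀(R)`, `|μ₂| < |μ₁|`, `|μ₁| (M + 1) ≤ Y₀(R)/2`.
[cite: Palasek2026ElementaryModel, §3.3] -/
theorem levelZeroDataAt_ringFamilyThin (ha : 0 < a) (h5 : a ≤ 5 / 256) (h5N : a ≤ 5 / R.N 0)
    (hκ : a ≤ strainConst / R.N 0) (hlt : |μ₂| < |μ₁|) (hmuY : |μ₁| * (ringSpeed + 1) ≤ R.Y 0 / 2) :
    LevelZeroDataAt R (tinyProfileAt R a + (μ₁ • ringPusher ringThin + μ₂ • mirrorRingPusher ringThin)) 7 := by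
  have ha2 : a ≤ 1 / 2 := h5.trans (by norm_num)
  obtain ⟨hsm, hdiv, hsupp⟩ := ringFamilyThin_static (R := R) ha ha2 μ₁ μ₂
  have hopen : IsOpen {y : EuclideanSpace ℝ (Fin 3) | ‖y‖ < 9 / 2} := isOpen_lt continuous_norm continuous_const
  have hfd : ∀ x : EuclideanSpace ℝ (Fin 3), ‖x‖ < 9 / 2 →
      fderiv ℝ (tinyProfileAt R a + (μ₁ • ringPusher ringThin + μ₂ • mirrorRingPusher ringThin)) x =
        fderiv ℝ (tinyProfileAt R a) x := fun x hx => by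
    have hev : tinyProfileAt R a + (μ₁ • ringPusher ringThin + μ₂ • mirrorRingPusher ringThin) =ᶠ[𝓝 x]
        tinyProfileAt R a := by
      filter_upwards [hopen.mem_nhds hx] with y hy
      exact ringFamilyThin_near R a μ₁ μ₂ hy
    exact hev.fderiv_eq
  refine { smooth := hsm, support := hsupp, divFree := hdiv, ceiling := (norm_ringFamilyThin_le_Y ha ha2 hlt.le hmuY).1,
           floor := ⟨0, by simp, ?_⟩, strain := ?_, core := ?_,
           anchor := fun x hx => ?_ }
  · rw [ringFamilyThin_near R a μ₁ μ₂ (by simp), (tinyProfileAt_zero R a).2]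
  · have hn : ‖a • strainPt‖ ≤ 2 * a := by
      rw [norm_smul, Real.norm_eq_abs, abs_of_pos ha]; nlinarith [norm_strainPt_le]
    refine ⟨a • strainPt, by linarith, ?_⟩
    rw [hfd _ (by linarith)]
    exact strain_tinyProfileAt ha hκ
  · obtain ⟨x, γ, hx, hγ, h01, hball, hvel, hcirc⟩ := core_tinyProfileAt (R := R) ha h5N
    refine ⟨x, γ, by linarith, hγ, h01, hball, hvel, ?_⟩
    have hc : circulation (tinyProfileAt R a + (μ₁ • ringPusher ringThin + μ₂ • mirrorRingPusher ringThin)) γ =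
        circulation (tinyProfileAt R a) γ := by
      unfold circulation
      refine intervalIntegral.integral_congr fun s hs => ?_
      rw [uIcc_of_le zero_le_one] at hs
      have hs' : ‖γ s‖ < 9 / 2 := by
        have hb := hball s hs
        rw [mem_closedBall, dist_eq_norm] at hb
        have h1N : 1 / R.N 0 ≤ 1 := by
          rw [div_le_one (R.N_pos 0)]; exact (R.one_lt_N 0).le
        have : ‖γ s‖ ≤ ‖γ s - x‖ + ‖x‖ := norm_le_norm_sub_add (γ s) x
        linarith
      simp only [ringFamilyThin_near R a μ₁ μ₂ hs']
    rw [hc]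
    exact hcirc
  · obtain rfl := (norm_ringFamilyThin_le_Y ha ha2 hlt.le hmuY).2 x hx
    exact (strictAnchor_tinyProfileAt_ringFamilyThin_iff R ha (by linarith) 1 μ₁ μ₂).2 hlt

/-- **LEVEL 0 ⟺ THE RING ABOVE OUT-WEIGHS THE RING BELOW** (small-amplitude regime: `0 < a ≤ 5/256`, `a ≤ 5/N₀(R)`,
`a ≤ strainConst/N₀(R)`, `max |μ₁| |μ₂| · (M + 1) ≤ Y₀(R)/2`):
`LevelZeroDataAt R (tinyProfileAt R a + (μ₁ • ringPusher ringThin + μ₂ • mirrorRingPusher ringThin)) 7 ↔ |μ₂| < |μ₁|`.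
[cite: Palasek2026ElementaryModel, §3.3] [cite: MajdaBertozziCUP2002, §1.8 Prop. 1.16] -/
theorem levelZeroDataAt_ringFamilyThin_iff (ha : 0 < a) (h5 : a ≤ 5 / 256) (h5N : a ≤ 5 / R.N 0)
    (hκ : a ≤ strainConst / R.N 0) (hmuY : max |μ₁| |μ₂| * (ringSpeed + 1) ≤ R.Y 0 / 2) :
    LevelZeroDataAt R (tinyProfileAt R a + (μ₁ • ringPusher ringThin + μ₂ • mirrorRingPusher ringThin)) 7 ↔ |μ₂| < |μ₁| := by
  refine ⟨fun hL => abs_lt_abs_of_levelZeroDataAt_ringFamilyThin R ha (h5.trans (by norm_num)) hL, fun hlt => ?_⟩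
  have h1 : |μ₁| * (ringSpeed + 1) ≤ R.Y 0 / 2 := by
    have hM := ringSpeed_spec.1
    nlinarith [le_max_left |μ₁| |μ₂|]
  exact levelZeroDataAt_ringFamilyThin ha h5 h5N hκ hlt h1

end Summit.NavierStokesRegularity.EpisodeBaseTRingFamilyThinLevelZeroIff

end
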